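import Literature.Computability.AlgebraicComplexity.KIReductionCodes
import HarnessLib

/-!
# Kabanets–Impagliazzo, Cor. 12: the instance with explicit offsets

Fourth file of the discharge of the reduction fact
`Literature.Computability.AlgebraicComplexity.permanent01Graph_polyExists_preimage_PIT`
(`PermanentGraphNSUBEXP.lean`). The instance `kiCircuit n M v P` (`KIReductionInstance.lean`) is
defined by threading the growing gate list through the emission (every new gate refers to
`gs.length`), which is the convenient form for its semantics; the reduction MACHINE, on the other
hand, writes the code of level `i` as a pure function of the input and `i`, computing every
absolute index by arithmetic. This file restates the instance in that second form and proves the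
two agree:

* `useLen`, `levelLen`, `levelBase` — the number of gates of a use, of a level, and the offset
  `G_i = Σ_{i'<i} levelLen i'` at which level `i` starts;
* `roundBase`, `roundGates`, `roundsGates`, `dAfter`, `level0Gates`, `levelSuccGates`,
  `allLevelGates`, `finalGates` — the gates of round `j` of level `i`, of the levels, of the
  evaluation identity, with all references written as arithmetic expressions in the offsets;
* `levels_gates`/`levels_acc`, **`kiCircuit_gates`**/**`kiCircuit_output`** — `kiCircuit n M v P`
  is these explicit gate lists in order, with output `gate (G_{n+1} + useLen (P n) + 2)`;
* `length_kiCircuit_gates` and the crude polynomial bounds `levelBase_le`, used by the machine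
  files to unclip.

## References

* V. Kabanets, R. Impagliazzo, *Derandomizing polynomial identity tests means proving circuit
  lower bounds*, STOC 2003, Lemma 11 and proof of Cor. 12 (p. 358).
-/

noncomputable section

namespace Literature.Computability.AlgebraicComplexity

namespace KIReduction

open ArithCircuit

variable (n : ℕ)

/-! ### Sizes and offsets -/

/-- The number of gates of a use of the block `B`: guard, `n²` layer gates, the block. [folklore] -/
def useLen (B : KBlock) : ℕ := n * n + B.length + 1

/-- `useLen = useOut + 1`. [folklore] -/
theorem useLen_eq (B : KBlock) : useLen n B = useOut (n * n) B + 1 := rfl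

/-- The number of gates of level `i`. [folklore] -/
def levelLen (P : ℕ → KBlock) (i : ℕ) : ℕ :=
  if i = 0 then useLen n (P 0) + 3 else useLen n (P i) + i * (useLen n (P (i - 1)) + 2) + 2

/-- **The offset of level `i`**: `G_i = Σ_{i' < i} levelLen i'`. [folklore] -/
def levelBase (P : ℕ → KBlock) : ℕ → ℕ
  | 0 => 0
  | i + 1 => levelBase P i + levelLen n P i

/-- The offset of round `j` of level `i ≥ 1` started at `G`. [folklore] -/
def roundBase (P : ℕ → KBlock) (i j G : ℕ) : ℕ := G + useLen n (P i) + j * (useLen n (P (i - 1)) + 2)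

/-- The next round starts `useLen (P (i-1)) + 2` gates later. [folklore] -/
theorem roundBase_succ (P : ℕ → KBlock) (i j G : ℕ) :
    roundBase n P i (j + 1) G = roundBase n P i j G + useLen n (P (i - 1)) + 2 := by
  simp only [roundBase, Nat.succ_mul]; omega

/-! ### The explicit gate lists -/

/-- The operand holding the partial identity of level `i` after `j` rounds: the output of the use
of `Pᵢ` for `j = 0`, else the last gate of round `j − 1`. [folklore] -/
def dAfter (P : ℕ → KBlock) (i G j : ℕ) : Opnd n :=
  if j = 0 then .gate (G + useOut (n * n) (P i)) else .gate (roundBase n P i j G - 1)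

/-- **Round `j` of level `i`** (offset `G`): the use of `P_{i−1}` behind the minor layer of
column `j`, the product `x_{0j} · (its output)`, the new partial identity. [cite: KabanetsImpagliazzo2003, Lemma 11 (2) (p. 358)] -/
def roundGates (P : ℕ → KBlock) (i j G : ℕ) : Gates n :=
  useGates (roundBase n P i j G) (minorLayer n i j) (P (i - 1)) ++
    [.prod [(varEntry n j).toOperand, .gate (roundBase n P i j G + useOut (n * n) (P (i - 1)))],
     .sum [(1, dAfter n P i G j), (-1, .gate (roundBase n P i j G + useOut (n * n) (P (i - 1)) + 1))]]

/-- A round has `useLen (P (i-1)) + 2` gates. [folklore] -/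
@[simp] theorem length_roundGates (P : ℕ → KBlock) (i j G : ℕ) :
    (roundGates n P i j G).length = useLen n (P (i - 1)) + 2 := by
  simp [roundGates, useLen]

/-- The first `j` rounds of level `i`. [folklore] -/
def roundsGates (P : ℕ → KBlock) (i G : ℕ) : ℕ → Gates n
  | 0 => []
  | j + 1 => roundsGates P i G j ++ roundGates n P i j G

/-- `j` rounds have `j · (useLen (P (i-1)) + 2)` gates. [folklore] -/
@[simp] theorem length_roundsGates (P : ℕ → KBlock) (i G : ℕ) : ∀ j,
    (roundsGates n P i G j).length = j * (useLen n (P (i - 1)) + 2)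
  | 0 => by simp [roundsGates]
  | j + 1 => by rw [roundsGates, List.length_append, length_roundsGates P i G j, length_roundGates]; ring

/-- **Level `0`** at offset `G` with running-sum operand `a`. [cite: KabanetsImpagliazzo2003, Lemma 11 (1) (p. 358)] -/
def level0Gates (P : ℕ → KBlock) (G : ℕ) (a : Opnd n) : Gates n :=
  useGates G (idL n) (P 0) ++
    [.sum [(1, .gate (G + useOut (n * n) (P 0))), (-1, .const 1)],
     .prod [.gate (G + useLen n (P 0)), .gate (G + useLen n (P 0))],
     .sum [(1, a), (1, .gate (G + useLen n (P 0) + 1))]]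

/-- **Level `i ≥ 1`** at offset `G` with running-sum operand `a`. [cite: KabanetsImpagliazzo2003, Lemma 11 (2) (p. 358)] -/
def levelSuccGates (P : ℕ → KBlock) (i G : ℕ) (a : Opnd n) : Gates n :=
  useGates G (idL n) (P i) ++ roundsGates n P i G i ++
    [.prod [dAfter n P i G i, dAfter n P i G i], .sum [(1, a), (1, .gate (roundBase n P i i G))]]

/-- Length of level `0`. [folklore] -/
@[simp] theorem length_level0Gates (P : ℕ → KBlock) (G : ℕ) (a : Opnd n) :
    (level0Gates n P G a).length = levelLen n P 0 := by
  simp [level0Gates, levelLen, useLen]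

/-- Length of level `i ≥ 1`. [folklore] -/
theorem length_levelSuccGates (P : ℕ → KBlock) {i : ℕ} (hi : i ≠ 0) (G : ℕ) (a : Opnd n) :
    (levelSuccGates n P i G a).length = levelLen n P i := by
  simp only [levelSuccGates, List.length_append, length_useGates, length_roundsGates, List.length_cons,
    List.length_nil, levelLen, hi, if_false, useLen]

/-- **All levels `0, …, i`**, each at its offset, each adding to the previous running sum. [cite: KabanetsImpagliazzo2003, Lemma 11 (p. 358)] -/
def allLevelGates (P : ℕ → KBlock) : ℕ → Gates n
  | 0 => level0Gates n P 0 (.const 0)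
  | i + 1 => allLevelGates P i ++ levelSuccGates n P (i + 1) (levelBase n P (i + 1)) (.gate (levelBase n P (i + 1) - 1))

/-- Length of all levels up to `i`: the offset of level `i + 1`. [folklore] -/
@[simp] theorem length_allLevelGates (P : ℕ → KBlock) : ∀ i, (allLevelGates n P i).length = levelBase n P (i + 1)
  | 0 => by simp [allLevelGates, levelBase]
  | i + 1 => by
    rw [allLevelGates, List.length_append, length_allLevelGates P i, length_levelSuccGates n P (Nat.succ_ne_zero i)]
    rfl

/-- **The evaluation identity** at offset `G` with running-sum operand `a`. [cite: KabanetsImpagliazzo2003, proof of Cor. 12 (p. 358)] -/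
def finalGates (M : Fin n → Fin n → ℤ) (v : ℤ) (P : ℕ → KBlock) (G : ℕ) (a : Opnd n) : Gates n :=
  useGates G (constLayer n M) (P n) ++
    [.sum [(1, .gate (G + useOut (n * n) (P n))), (-1, .const v)],
     .prod [.gate (G + useLen n (P n)), .gate (G + useLen n (P n))],
     .sum [(1, a), (1, .gate (G + useLen n (P n) + 1))]]

/-- Length of the evaluation identity. [folklore] -/
@[simp] theorem length_finalGates (M : Fin n → Fin n → ℤ) (v : ℤ) (P : ℕ → KBlock) (G : ℕ) (a : Opnd n) :
    (finalGates n M v P G a).length = useLen n (P n) + 3 := by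
  simp [finalGates, useLen]

/-! ### The threaded emission is the explicit layout -/

variable {n}

/-- The gates of `closeIdentity`. [folklore] -/
theorem closeIdentity_gates (st : Emit n) (d : Opnd n) :
    (closeIdentity n st d).gates = st.gates ++ [.prod [d, d], .sum [(1, st.acc), (1, .gate st.gates.length)]] := by
  simp [closeIdentity, emitGate, List.append_assoc]

/-- The running-sum operand after `closeIdentity`. [folklore] -/
theorem closeIdentity_acc (st : Emit n) (d : Opnd n) :
    (closeIdentity n st d).acc = .gate (st.gates.length + 1) := by
  simp [closeIdentity, emitGate]

/-- The gates of `level0`. [folklore] -/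
theorem level0_gates (st : Emit n) (P : ℕ → KBlock) :
    (level0 n st (P 0)).gates = st.gates ++ level0Gates n P st.gates.length st.acc := by
  rw [level0, closeIdentity_gates]
  simp only [emitUse, emitGate, List.length_append, length_useGates, List.length_singleton]
  simp only [level0Gates, useLen, useOut, List.append_assoc, List.cons_append, List.nil_append]

/-- The running-sum operand after `level0`. [folklore] -/
theorem level0_acc (st : Emit n) (P : ℕ → KBlock) :
    (level0 n st (P 0)).acc = .gate (st.gates.length + levelLen n P 0 - 1) := by
  have h : st.gates.length + (n * n + (P 0).length + 1) + 1 + 1 = st.gates.length + levelLen n P 0 - 1 := by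
    simp only [levelLen, if_true, useLen]; omega
  rw [level0, closeIdentity_acc]
  simp only [emitUse, emitGate, List.length_append, length_useGates, List.length_singleton, h]

/-- **The minor loop spelled out** (level `i + 1`): after `j` rounds from `(gs₀, gate o)` with
`|gs₀| = roundBase 0` and `o` the output of the use of `P (i+1)`, the gates are `gs₀` followed by
the first `j` rounds and the operand is `dAfter j`. [folklore] -/
theorem minorLoop_eq (P : ℕ → KBlock) (i G : ℕ) {gs₀ : Gates n} (h₀ : gs₀.length = roundBase n P (i + 1) 0 G) :
    ∀ j, minorLoop n (i + 1) (P i) j (gs₀, .gate (G + useOut (n * n) (P (i + 1)))) =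
      (gs₀ ++ roundsGates n P (i + 1) G j, dAfter n P (i + 1) G j)
  | 0 => by simp [minorLoop, roundsGates, dAfter]
  | j + 1 => by
    rw [minorLoop, minorLoop_eq P i G h₀ j]
    have hlen : (gs₀ ++ roundsGates n P (i + 1) G j).length = roundBase n P (i + 1) j G := by
      rw [List.length_append, h₀, length_roundsGates, roundBase, roundBase]; ring
    have hlen' : gs₀.length + (roundsGates n P (i + 1) G j).length = roundBase n P (i + 1) j G := by
      rw [← List.length_append, hlen]
    refine Prod.ext ?_ ?_
    · simp only [emitUse, emitGate]
      simp only [List.length_append, length_useGates, hlen']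
      simp only [roundsGates, roundGates, Nat.add_sub_cancel, useOut, List.append_assoc, List.cons_append,
        List.nil_append, Nat.add_assoc]
    · have h2 : roundBase n P (i + 1) j G + (n * n + (P i).length + 1) + 1 = roundBase n P (i + 1) (j + 1) G - 1 := by
        rw [roundBase_succ, useLen, Nat.add_sub_cancel]; omega
      simp only [emitUse, emitGate]
      simp only [List.length_append, length_useGates, List.length_singleton, hlen', dAfter, Nat.succ_ne_zero,
        if_false, h2]

/-- The gates of `levelSucc` (level `i + 1`). [folklore] -/
theorem levelSucc_gates (st : Emit n) (P : ℕ → KBlock) (i : ℕ) :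
    (levelSucc n st (i + 1) (P (i + 1)) (P i)).gates =
      st.gates ++ levelSuccGates n P (i + 1) st.gates.length st.acc := by
  rw [levelSucc]
  have h₀ : (st.gates ++ useGates st.gates.length (idL n) (P (i + 1))).length = roundBase n P (i + 1) 0 st.gates.length := by
    simp [roundBase, useLen]
  simp only [emitUse]
  rw [minorLoop_eq P i st.gates.length h₀ (i + 1), closeIdentity_gates]
  simp only [List.length_append, length_useGates, length_roundsGates]
  simp only [levelSuccGates, roundBase, useLen, Nat.add_sub_cancel, List.append_assoc, Nat.add_assoc]

/-- The running-sum operand after `levelSucc` (level `i + 1`). [folklore] -/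
theorem levelSucc_acc (st : Emit n) (P : ℕ → KBlock) (i : ℕ) :
    (levelSucc n st (i + 1) (P (i + 1)) (P i)).acc = .gate (st.gates.length + levelLen n P (i + 1) - 1) := by
  rw [levelSucc]
  have h₀ : (st.gates ++ useGates st.gates.length (idL n) (P (i + 1))).length = roundBase n P (i + 1) 0 st.gates.length := by
    simp [roundBase, useLen]
  simp only [emitUse]
  rw [minorLoop_eq P i st.gates.length h₀ (i + 1), closeIdentity_acc]
  simp only [List.length_append, length_useGates, length_roundsGates, levelLen, Nat.succ_ne_zero, if_false,
    useLen, Nat.add_sub_cancel]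
  congr 1
  have : 1 ≤ (i + 1) * (n * n + (P i).length + 1 + 2) + 2 := by omega
  omega

/-- **The levels spelled out**: the gates are `allLevelGates`, the running-sum operand is the
last gate. [folklore] -/
theorem levels_gates_acc (P : ℕ → KBlock) : ∀ i,
    (levels n P i).gates = allLevelGates n P i ∧ (levels n P i).acc = .gate (levelBase n P (i + 1) - 1)
  | 0 => by
    refine ⟨by rw [levels, level0_gates]; simp [allLevelGates], ?_⟩
    rw [levels, level0_acc]; simp [levelBase]
  | i + 1 => by
    obtain ⟨hg, ha⟩ := levels_gates_acc P i
    refine ⟨by rw [levels, levelSucc_gates, hg, ha, length_allLevelGates, allLevelGates], ?_⟩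
    rw [levels, levelSucc_acc, hg, length_allLevelGates]
    simp only [levelBase]

/-- The gates of the levels. [folklore] -/
theorem levels_gates (P : ℕ → KBlock) (i : ℕ) : (levels n P i).gates = allLevelGates n P i :=
  (levels_gates_acc P i).1

/-- The running-sum operand of the levels. [folklore] -/
theorem levels_acc (P : ℕ → KBlock) (i : ℕ) : (levels n P i).acc = .gate (levelBase n P (i + 1) - 1) :=
  (levels_gates_acc P i).2

/-- **`kiCircuit` with explicit offsets**: gates — all levels, then the evaluation identity at
offset `G_{n+1}`. [cite: KabanetsImpagliazzo2003, Lemma 11 and proof of Cor. 12 (p. 358)] -/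
theorem kiCircuit_gates (M : Fin n → Fin n → ℤ) (v : ℤ) (P : ℕ → KBlock) :
    (kiCircuit n M v P).gates =
      allLevelGates n P n ++ finalGates n M v P (levelBase n P (n + 1)) (.gate (levelBase n P (n + 1) - 1)) := by
  show (finalStep n (levels n P n) M v (P n)).gates = _
  rw [finalStep, closeIdentity_gates]
  simp only [emitUse, emitGate, levels_gates, levels_acc, List.length_append, length_allLevelGates,
    length_useGates, List.length_singleton]
  simp only [finalGates, useLen, useOut, List.append_assoc, List.cons_append, List.nil_append]

/-- **`kiCircuit` with explicit offsets**: the output is the last gate. [cite: KabanetsImpagliazzo2003, proof of Cor. 12 (p. 358)] -/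
theorem kiCircuit_output (M : Fin n → Fin n → ℤ) (v : ℤ) (P : ℕ → KBlock) :
    (kiCircuit n M v P).output = .gate (levelBase n P (n + 1) + useLen n (P n) + 2) := by
  show (finalStep n (levels n P n) M v (P n)).acc = _
  rw [finalStep, closeIdentity_acc]
  simp only [emitUse, emitGate, levels_gates, List.length_append, length_allLevelGates, length_useGates,
    List.length_singleton, useLen]

/-- The number of gates of the instance. [folklore] -/
theorem length_kiCircuit_gates (M : Fin n → Fin n → ℤ) (v : ℤ) (P : ℕ → KBlock) :
    (kiCircuit n M v P).gates.length = levelBase n P (n + 1) + useLen n (P n) + 3 := by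
  rw [kiCircuit_gates, List.length_append, length_allLevelGates, length_finalGates, Nat.add_assoc]

/-! ### Crude bounds for unclipping -/

/-- A level has at most `(i + 1)(n² + s + 3) + 3` gates when blocks have at most `s` gates. [folklore] -/
theorem levelLen_le {P : ℕ → KBlock} {s : ℕ} (hs : ∀ i, (P i).length ≤ s) (i : ℕ) :
    levelLen n P i ≤ (i + 1) * (n * n + s + 3) + 3 := by
  unfold levelLen useLen
  have h1 := hs i; have h2 := hs (i - 1); have h0 := hs 0
  split_ifs
  · nlinarith
  · have : i * (n * n + (P (i - 1)).length + 1 + 2) ≤ i * (n * n + s + 3) := Nat.mul_le_mul_left i (by omega)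
    nlinarith

/-- The offsets are at most quadratic in the level: `G_i ≤ i (i + 1) (n² + s + 3) + 3 i`. [folklore] -/
theorem levelBase_le {P : ℕ → KBlock} {s : ℕ} (hs : ∀ i, (P i).length ≤ s) : ∀ i,
    levelBase n P i ≤ i * (i + 1) * (n * n + s + 3) + 3 * i
  | 0 => by simp [levelBase]
  | i + 1 => by
    have h := levelBase_le hs i
    have hl := levelLen_le (n := n) hs i
    rw [levelBase]
    nlinarith

end KIReduction

end Literature.Computability.AlgebraicComplexity

end
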